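/-
Copyright: statement-level skeleton of a published paper (lit-balaban cell, Phase-2 proof seat p10, gen 5). No proof claims
beyond what the kernel checks below.
-/
import Mathlib
import Literature.MathematicalPhysics.QuantumFieldTheory.BalabanImbrieJaffe1984to88.BIJ85FibreDuality

/-!
# `BalabanImbrieJaffe1984to88.BIJ85FibreDualBound` — T. Bałaban, J. Imbrie, A. Jaffe, *Renormalization of the Higgs model:
minimizers, propagators and the stability of mean field theory*, Commun. Math. Phys. **97** (1985) 299–329
[BalabanImbrieJaffe1985]: Sect. 7.1 (7.1.12)–(7.1.16), (7.1.19), (7.1.21) pp. 322–324 — **the dual bound for the fibre problem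
with the τ₀ part and the τ₂ part**, every block size n = L^k (even L included): for a co-closed antisymmetric g at the central
offset (the (∂𝒦)^⊥ component of (7.1.19), on which τ₀ (7.1.28) acts) and a multiplier Λ ⊥ ∂^{(1)}(p′) (the τ₂ mechanism (7.1.15)),
`[2Re⟨g,B_0⟩ − ‖g‖²] + [2Re Σ_νΛ_νA_ν(φ) − Σ_ν φ_ν(p′)|Λ_ν|²] ≤ E_{p′}(α,φ)` for every α with Q_kα = 0 — sibling of
`BIJ85FibreDuality` (test family T_l = δ_{l0}g + Z_l in its `weak_duality`; file 1b of seat p10 gen 5's all-n chain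
`BIJ85FibreDuality`/`BIJ85FibreDualBound` → `BIJ85FibreCurlIntertwine` → `BIJ85FibreOffCentre` → `BIJ85Thm711AllL`)

statement-level skeleton of published theorems with citation tags; proofs where landed; nothing here is a claim about
the Yang–Mills mass gap

PDF held: `paper:balaban1985-cmp97-bij-higgs-minimizers` (journal page = PDF page + 298).  Renders read as images: PDF pp.
23–27 (journal 321–325), `run/shared/lean/pub/pub-balaban/t4/b2b-balaban-t4-lit2/renders/bij1985/…-p023…p027-x2.png`.

CITATION HEADER (lean-in-tree rule).  Part of the lit-balaban TYPED SKELETON (HOME `run/shared/lean/pub/lit-balaban/`); WHAT IS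
REPRODUCED: the structure of SKELETON rows **C1.Eq7.1.13-7.1.19** / **C1.Thm7.1.1** (`HOME/lit-balaban-r15/ROWS-C1.md`, fold
owner r15, referee ref-5): p. 322 *"We express σ_k as a sum of two terms σ_k = τ₁ + τ₂. (7.1.13) Here τ₁ vanishes on curls"*;
p. 324 *"ε ≤ τ₀(p)↾(∂𝒦(p))^⊥ and ε ≤ τ₂(p)↾∂𝒦(p). (7.1.21)"* — the dual value below is the sum of a τ₀-type term (the co-closed
test form g at l = 0) and a τ₂-type term (the multiplier Λ), and it bounds the constrained fibre energy from below.
WHAT IS KERNEL-CHECKED (zero `sorry`, standard axioms), every n ≥ 1: **`dual_bound`** (statement in the module summary above;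
notation of `BIJ85FibreDuality`: `srcK` = B_l, `AK` = A_ν, `phiK` = φ_ν (7.1.10), `lapK` = Δ(p′+l)); the g–Z_0 cross terms
vanish because g is co-closed and Z_0 is an η-curl (`BIJ85FibreDuality.pair_zK`).  NOT CLAIMED here: the choice of (g, Λ)
and the estimates (files 2–4).  Unit `lit-balaban-p10` (gen 5), HOME as above.
-/

namespace Literature.MathematicalPhysics.QuantumFieldTheory.BalabanImbrieJaffe1984to88.BIJ85FibreDualBound

open scoped BigOperators ComplexConjugate
open Complex Finset
open Literature.MathematicalPhysics.QuantumFieldTheory.Balaban1983to89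
open Literature.MathematicalPhysics.QuantumFieldTheory.Balaban1983to89.B5Prop11Plancherel
open Literature.MathematicalPhysics.QuantumFieldTheory.Balaban1983to89.B5Prop11Fiber
open Literature.MathematicalPhysics.QuantumFieldTheory.BalabanImbrieJaffe1984to88.BIJ85Eq7111EdgeAverage
open Literature.MathematicalPhysics.QuantumFieldTheory.BalabanImbrieJaffe1984to88.BIJ85Eq7112FibreEnergy
open Literature.MathematicalPhysics.QuantumFieldTheory.BalabanImbrieJaffe1984to88.BIJ85FibreDuality

noncomputable section

variable {d : ℕ} (n : ℕ) [NeZero n] (M : Fin d → ℕ)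

/-- kernel: |z + w|² = |z|² + |w|² + 2Re(z w̄) for complex numbers. [folklore] -/
private theorem norm_add_sq_complex (z w : ℂ) : ‖z + w‖ ^ 2 = ‖z‖ ^ 2 + ‖w‖ ^ 2 + 2 * (z * conj w).re := by
  rw [← Complex.normSq_eq_norm_sq, ← Complex.normSq_eq_norm_sq, ← Complex.normSq_eq_norm_sq]
  exact Complex.normSq_add z w

/-- **THE DUAL BOUND**: for every n ≥ 1, every unit momentum p′ with no Δ(p′+l) = 0 (i.e. p′ ≠ 0), every antisymmetric φ, every α
obeying the fibre constraint, every antisymmetric g CO-CLOSED at l = 0 (Σ_μ ∂̄_μ(p′)g(μ,ν) = 0 — the τ₀/(∂𝒦)^⊥ part of (7.1.19),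
(7.1.28)) and every multiplier Λ with Σ_ν ∂^{(1)}_ν(p′)Λ_ν = 0 (the τ₂ part):
`[2Re⟨g, B_0⟩ − ‖g‖²] + [2Re Σ_ν Λ_νA_ν(φ) − Σ_ν φ_ν(p′)|Λ_ν|²] ≤ E_{p′}(α, φ)`.  (Test family T_l = δ_{l0}g + Z_l in `weak_duality`;
the g–Z_0 cross terms vanish because g is co-closed and Z_0 is exact.) [cite: BalabanImbrieJaffe1985, (7.1.13) p.322] -/
theorem dual_bound (q : Tor M) (φ : Fin d × Fin d → ℂ) (hφ : ∀ μ ν, φ (ν, μ) = -φ (μ, ν))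
    (α : (Fin d → Fin n) → Fin d → ℂ) (hα : FibreConstraint n M q α) (hΔ : ∀ k, lapK n M q k ≠ 0)
    (g : Fin d → Fin d → ℂ) (hg : ∀ μ ν, g ν μ = -g μ ν)
    (hdiv : ∀ ν, ∑ μ, conj (dSym n 0 (sOf M q) μ) * g μ ν = 0)
    (Λ : Fin d → ℂ) (hΛ : ∑ ν, d1Sym (sOf M q) ν * Λ ν = 0) :
    (∑ μ, ∑ ν, (2 * (conj (g μ ν) * srcK n M q φ 0 μ ν).re - ‖g μ ν‖ ^ 2))
      + (2 * (∑ ν, Λ ν * AK n M q φ ν).re - ∑ ν, phiK n M q ν * ‖Λ ν‖ ^ 2) ≤ fibreEnergy n M q α φ := by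
  classical
  -- the test family
  set G : (Fin d → Fin n) → Fin d → Fin d → ℂ := fun k μ ν => if k = 0 then g μ ν else 0 with hGdef
  set T : (Fin d → Fin n) → Fin d → Fin d → ℂ := fun k μ ν => G k μ ν + zK n M q Λ k μ ν with hTdef
  have hGa : ∀ k μ ν, G k ν μ = -G k μ ν := by
    intro k μ ν
    simp only [hGdef]
    split_ifs
    · exact hg μ ν
    · simp
  have hTa : ∀ k μ ν, T k ν μ = -T k μ ν := by
    intro k μ ν
    simp only [hTdef]
    rw [hGa, zK_antisymm]
    ring
  -- g is co-closed: Σ_μ ∂_μ(p′) ḡ(μ,ν) = 0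
  have hg0 : ∀ ν, ∑ μ, dSym n 0 (sOf M q) μ * conj (g μ ν) = 0 := by
    intro ν
    have h := congrArg conj (hdiv ν)
    rw [map_sum, map_zero] at h
    rw [← h]
    exact Finset.sum_congr rfl fun μ _ => by rw [map_mul, Complex.conj_conj, mul_comm]
  have hfeas : ∀ k ν, 2 * ∑ μ, dSym n k (sOf M q) μ * conj (T k μ ν) = Λ ν * rK n M q k ν := by
    intro k ν
    have hz := zK_feasible n M q Λ hΛ hΔ k ν
    have hsplit : ∑ μ, dSym n k (sOf M q) μ * conj (T k μ ν)
        = ∑ μ, dSym n k (sOf M q) μ * conj (G k μ ν) + ∑ μ, dSym n k (sOf M q) μ * conj (zK n M q Λ k μ ν) := by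
      rw [← Finset.sum_add_distrib]
      exact Finset.sum_congr rfl fun μ _ => by simp only [hTdef, map_add]; ring
    rw [hsplit]
    by_cases hk : k = 0
    · subst hk
      simp only [hGdef, if_true]
      rw [hg0 ν, zero_add]
      exact hz
    · simp only [hGdef, if_neg hk, map_zero, mul_zero, Finset.sum_const_zero, zero_add]
      exact hz
  have hwd := weak_duality n M q φ α hα T hTa Λ hfeas
  -- evaluation of the pairing term
  have hpair : ∑ k, ∑ μ, ∑ ν, 2 * (conj (T k μ ν) * srcK n M q φ k μ ν).re
      = ∑ μ, ∑ ν, 2 * (conj (g μ ν) * srcK n M q φ 0 μ ν).re + 2 * (∑ ν, Λ ν * AK n M q φ ν).re := by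
    have hZ : ∀ k, ∑ μ, ∑ ν, conj (zK n M q Λ k μ ν) * srcK n M q φ k μ ν
        = ∑ ν, Λ ν * (rK n M q k ν * divK n M q φ k ν / (lapK n M q k : ℂ)) := by
      intro k
      rw [pair_zK n M q Λ k (srcK n M q φ k) (srcK_antisymm n M q hφ k), Finset.mul_sum]
      refine Finset.sum_congr rfl fun ν _ => ?_
      rw [conj_xK, divK]
      ring
    have hG : ∀ k, ∑ μ, ∑ ν, 2 * (conj (G k μ ν) * srcK n M q φ k μ ν).re
        = if k = 0 then ∑ μ, ∑ ν, 2 * (conj (g μ ν) * srcK n M q φ 0 μ ν).re else 0 := by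
      intro k
      by_cases hk : k = 0
      · subst hk
        simp only [hGdef, if_true]
      · simp only [hGdef, if_neg hk, map_zero, zero_mul, Complex.zero_re, mul_zero, Finset.sum_const_zero]
    calc ∑ k, ∑ μ, ∑ ν, 2 * (conj (T k μ ν) * srcK n M q φ k μ ν).re
        = ∑ k, (∑ μ, ∑ ν, 2 * (conj (G k μ ν) * srcK n M q φ k μ ν).re
            + 2 * (∑ μ, ∑ ν, conj (zK n M q Λ k μ ν) * srcK n M q φ k μ ν).re) := by
          refine Finset.sum_congr rfl fun k _ => ?_
          simp only [hTdef, map_add, add_mul, Complex.add_re, mul_add, Finset.sum_add_distrib, Complex.re_sum,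
            Finset.mul_sum]
      _ = ∑ k, (∑ μ, ∑ ν, 2 * (conj (G k μ ν) * srcK n M q φ k μ ν).re)
            + 2 * (∑ k, ∑ ν, Λ ν * (rK n M q k ν * divK n M q φ k ν / (lapK n M q k : ℂ))).re := by
          rw [Finset.sum_add_distrib, Complex.re_sum, Finset.mul_sum]
          congr 1
          exact Finset.sum_congr rfl fun k _ => by rw [hZ k]
      _ = ∑ μ, ∑ ν, 2 * (conj (g μ ν) * srcK n M q φ 0 μ ν).re + 2 * (∑ ν, Λ ν * AK n M q φ ν).re := by
          congr 1
          · simp_rw [hG]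
            rw [Finset.sum_ite_eq' Finset.univ (0 : Fin d → Fin n), if_pos (Finset.mem_univ _)]
          · congr 2
            rw [Finset.sum_comm]
            refine Finset.sum_congr rfl fun ν _ => ?_
            rw [AK, Finset.mul_sum]
  -- evaluation of the norm term
  have hnorm : ∑ k, ∑ μ, ∑ ν, ‖T k μ ν‖ ^ 2 ≤ ∑ μ, ∑ ν, ‖g μ ν‖ ^ 2 + ∑ ν, phiK n M q ν * ‖Λ ν‖ ^ 2 := by
    have hcross : ∀ k, ∑ μ, ∑ ν, 2 * (G k μ ν * conj (zK n M q Λ k μ ν)).re = 0 := by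
      intro k
      have h0 : ∑ μ, ∑ ν, conj (zK n M q Λ k μ ν) * G k μ ν = 0 := by
        rw [pair_zK n M q Λ k (G k) (hGa k)]
        by_cases hk : k = 0
        · subst hk
          simp only [hGdef, if_true]
          rw [Finset.sum_eq_zero fun ν _ => by rw [hdiv ν, mul_zero], mul_zero]
        · simp only [hGdef, if_neg hk, mul_zero, Finset.sum_const_zero]
      have h1 : ∑ μ, ∑ ν, 2 * (G k μ ν * conj (zK n M q Λ k μ ν)).re
          = 2 * (∑ μ, ∑ ν, conj (zK n M q Λ k μ ν) * G k μ ν).re := by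
        simp only [Complex.re_sum, Finset.mul_sum]
        exact Finset.sum_congr rfl fun μ _ => Finset.sum_congr rfl fun ν _ => by
          rw [mul_comm (G k μ ν) (conj (zK n M q Λ k μ ν))]
      rw [h1, h0, Complex.zero_re, mul_zero]
    have hGn : ∀ k, ∑ μ, ∑ ν, ‖G k μ ν‖ ^ 2 = if k = 0 then ∑ μ, ∑ ν, ‖g μ ν‖ ^ 2 else 0 := by
      intro k
      by_cases hk : k = 0
      · subst hk
        simp only [hGdef, if_true]
      · simp only [hGdef, if_neg hk, norm_zero]
        simp
    calc ∑ k, ∑ μ, ∑ ν, ‖T k μ ν‖ ^ 2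
        = ∑ k, (∑ μ, ∑ ν, ‖G k μ ν‖ ^ 2 + ∑ μ, ∑ ν, ‖zK n M q Λ k μ ν‖ ^ 2
            + ∑ μ, ∑ ν, 2 * (G k μ ν * conj (zK n M q Λ k μ ν)).re) := by
          refine Finset.sum_congr rfl fun k _ => ?_
          have hk : ∀ μ ν, ‖T k μ ν‖ ^ 2
              = ‖G k μ ν‖ ^ 2 + ‖zK n M q Λ k μ ν‖ ^ 2 + 2 * (G k μ ν * conj (zK n M q Λ k μ ν)).re :=
            fun μ ν => norm_add_sq_complex (G k μ ν) (zK n M q Λ k μ ν)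
          simp_rw [hk, Finset.sum_add_distrib]
      _ = ∑ μ, ∑ ν, ‖g μ ν‖ ^ 2 + ∑ k, ∑ μ, ∑ ν, ‖zK n M q Λ k μ ν‖ ^ 2 := by
          simp_rw [hcross, add_zero]
          rw [Finset.sum_add_distrib]
          simp_rw [hGn]
          rw [Finset.sum_ite_eq' Finset.univ (0 : Fin d → Fin n), if_pos (Finset.mem_univ _)]
      _ ≤ ∑ μ, ∑ ν, ‖g μ ν‖ ^ 2 + ∑ k, ∑ ν, ‖Λ ν‖ ^ 2 * ‖rK n M q k ν‖ ^ 2 / lapK n M q k :=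
          add_le_add le_rfl (Finset.sum_le_sum fun k _ => norm_zK_sum_le n M q Λ k (hΔ k))
      _ = ∑ μ, ∑ ν, ‖g μ ν‖ ^ 2 + ∑ ν, phiK n M q ν * ‖Λ ν‖ ^ 2 := by
          congr 1
          rw [Finset.sum_comm]
          refine Finset.sum_congr rfl fun ν _ => ?_
          rw [phiK, Finset.sum_mul]
          exact Finset.sum_congr rfl fun k _ => by ring
  -- assemble
  have hobj : ∑ k, ∑ μ, ∑ ν, (2 * (conj (T k μ ν) * srcK n M q φ k μ ν).re - ‖T k μ ν‖ ^ 2)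
      = ∑ k, ∑ μ, ∑ ν, 2 * (conj (T k μ ν) * srcK n M q φ k μ ν).re - ∑ k, ∑ μ, ∑ ν, ‖T k μ ν‖ ^ 2 := by
    simp only [Finset.sum_sub_distrib]
  have hg2 : ∑ μ, ∑ ν, (2 * (conj (g μ ν) * srcK n M q φ 0 μ ν).re - ‖g μ ν‖ ^ 2)
      = ∑ μ, ∑ ν, 2 * (conj (g μ ν) * srcK n M q φ 0 μ ν).re - ∑ μ, ∑ ν, ‖g μ ν‖ ^ 2 := by
    simp only [Finset.sum_sub_distrib]
  rw [hobj, hpair] at hwd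
  rw [hg2]
  linarith

end

end Literature.MathematicalPhysics.QuantumFieldTheory.BalabanImbrieJaffe1984to88.BIJ85FibreDualBound
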